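import Literature.MathematicalPhysics.QuantumFieldTheory.Balaban1983to89.FlowStepRuns
import Literature.MathematicalPhysics.QuantumFieldTheory.Balaban1983to89.B13
import Literature.MathematicalPhysics.QuantumFieldTheory.Balaban1983to89.B12Decay510

/-!
# `Balaban1983to89.Beta.RemainderChain` — the k-UNIFORM bound on the non-Gaussian remainder β¹ of the β-functions,
in the form the printed estimates actually give: `|β¹_{k+1}(g_0,…,g_k)| ≤ ε₁ · K_rem` (constant form), assembled from
[II] (2.41) ⟶ [I] (4.3)–(4.5), (4.37), (5.10) ⟶ [I] (1.22)/(5.42), and its consumers (kernel bookkeeping + real analysis;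
cell pub-balaban, β-function sub-cell row an4, record `BETA/REMAINDER-BETA.md`)

HONEST FRAMING (BETA-SPEC §0.2, verbatim and binding).  *"Discharging BetaPertH makes Bałaban's UV stability
UNCONDITIONAL — a real constructive-QFT result; it is NOT the continuum limit and NOT the Clay problem."*  This module
discharges NOTHING of the kind: it is a REDUCTION.  It proves, sorry-free, that the printed small-field estimates of
[II] §2 and [I] §§4–5 — entered BY NAME as hypotheses exactly as the modules `B13` and `B12Decay510` type them — bound the
non-one-loop part `β¹_{k+1}` of the β-functions by a constant `ε₁ · K_rem` with `K_rem` INDEPENDENT of the scale `k`, of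
the history `(g_0,…,g_k)` and of `ε₁`, and that this constant form is all that the located consumers of the flow use
(`FlowStepRuns.betaLowerTail_of_split_oneSided`, `…thm2Printed_of_boxBoundsH`, `…endpointExistence_of_eventualLower`).
The remaining located inputs are named in §7 below and in the cell records (BETA-SPEC §6; GAPS.md G-B12s-15, G-adv2-2,
G-B13-07…11, G-pv20-3).

CITATION HEADER (lean-in-tree rule 2026-08-18).  Typed skeleton of: T. Bałaban, *Renormalization group approach to
lattice gauge field theories. I. Generation of effective actions in a small field approximation and a coupling constant
renormalization in four dimensions*, Comm. Math. Phys. **109** (1987) 249–301 [Balaban1987RG1] = [I]; *II. Cluster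
expansions*, Comm. Math. Phys. **116** (1988) 1–22 [Balaban1988RG2Cluster] = [II]; T. Bałaban, *Large field
renormalization. II*, Comm. Math. Phys. **122** (1989) 355–392 [Balaban1989LargeFieldII] (consumer side only).  Page
numbers are the printed journal pages (PDF page = printed − 248 for [I], = printed for [II]); the quotations below were
read on the cell's page renders (b2b-balaban-ref1/pages/…: [I] p011, p016, p019, p020, p029, p033, p034, p043, p045,
p049; [II] p008, p015, p020, p021).  Bałaban's own later expositions are NOT used.  DOCFIX v1.2 (GAPS G-pv13g2-5 items
(2)–(5), cross-read C-pv13g2-17; docstring-only, every declaration byte-unchanged): the γ-sentences of Thm 2 / Thm 3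
quoted in their printed words (§1 table), (1.22) stated as printed (§0), the loci of the lattice sums K₀, K₁ ([II] (1.26)
p. 8 and [I] (0.26)/(0.30) pp. 257–258 — not (4.38)), and the page loci (4.5) p. 282, (5.42) p. 297, (3.37) p. 277.

## 0. What is bounded, and what "k-uniform" means here

[I] p. 264 (1.20)–(1.22): the vacuum polarization tensor `Π_{j+1}(g_j, b, b′)` is the second `B`-derivative at `B = 0`
of the scale-`(j+1)` effective action *"determined by the functions E^{(j+1)}(g_j, 𝐔_{j+1}) in (1.6)"*, its `T ↗ ℤ⁴`
limit `Π_{j+1}(g_j, x − x′)` after (1.21) (*"Now we take a limit of these functions as T^{(j+1)} ↗ Z^d. This limit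
exists by the localized representation (1.7). The function β_{j+1}(g_j) is defined by"*), and (1.22)
`β_{j+1}(g_j) = −(∂²/∂p₁∂p₂ Π̃_{j+1,12})(g_j, 0) = −(∂²/∂p_μ∂p_ν Π̃_{j+1,μν})(g_j, 0) = Σ_x Π_{j+1,μν}(g_j, x)x_μx_ν`
*"for μ, ν arbitrary, μ ≠ ν"* (= (5.42) p. 297 *"This is the fundamental equality defining the β-function."*; no
`δ_{μν}`, no prefactor — the kernel's `B12Beta.secondMoment` is this printed sum).  [I] p. 268 (2.12)–(2.15) and [II] p. 21 split that effective action into the Gaussian normalization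
`[log Z^{(k)}(𝐔_{k+1}) − log Z^{(k)}(1)]` ([I] p. 267: *"This quadratic form defines the k-th normalization factor
Z^{(k)}(𝐔_{k+1}) given by the formula (1.4) with j = k"* — coupling-free) and the functional `𝐄^{(k+1)}(g_k, 𝐔_{k+1})`
of (2.13) (*"the expression under the exponential above vanishes at g_k = 0"*).  (1.20) and (1.22) are LINEAR in the
action, so `β_{k+1} = β⁰_{k+1} + β¹_{k+1}` with `β⁰` from `log Z^{(k)}` (ONE LOOP; rows an1–an3 of the sub-cell) and
`β¹` from (2.13) — the cell's `B12Beta.OneLoopSplit` (fields `β0`, `β1`, `split`).  THIS MODULE BOUNDS `β¹`.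
"k-uniform" = one constant for all scales `k` and all histories in the box `]0,γ]^{k+1}`; the history enters the
printed bounds only through `g_k ≤ γ` ([II] p. 18, restriction R16 of the cell census), never through its length.

## 1. The printed chain and its constants (every constant k-free BY ITS PRINTED DEFINITION)

(L1) [II] Lemma 3 (2.38) p. 20 and (2.39)–(2.41) p. 21: *"|𝐄^{(k+1)}(X)| ≤ O(1)C₃ε₁ exp(−(1 − 10δ)½Lκd_{k+1}(X))"* on
`𝐔ᶜ_{k+1}(X, α₀, α₁)` ([II] p. 15: *"Thus the activities in (2.13), and the whole sum 𝐄^{(k+1)}(X), are analytic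
functions of (𝐔, 𝐉), on the space 𝐔ᶜ_{k+1}(X, α₀, α₁)"*), with [II] p. 20 *"C₃ = 2(L+2)⁴O(1)2E₀C₁α₄⁻¹α₆⁻¹M^q exp C₂κ₁"*
and the first "last assumption" p. 21 *"(1 − 10δ)½L = 1"* (R22).  Hence an (I.1.18)-type bound for the (2.13)-terms with
the ACTIVITY `A_rem := O(1)·C₃·ε₁` (`remActivity`; `bound118_linear_of_bound241With`) — print CONTINUES with the second
"last assumption" *"O(1)C₃ε₁ ≤ ½E₀ … unessential, because the constant C₃ε₁ is small anyway"* (R23) to get the constant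
`½E₀` it needs for the induction (`B13.bound118_of_bound241`); for the β-function one keeps the factor ε₁ instead.
(L2) [I] (4.3)–(4.4) p. 281 (*"Thus it is defined and analytic on the space of configurations 𝐀 satisfying
max{|𝐀|_X, |P₁(□₀)𝐀|_X, |∇^ξ𝐀|_X, |Δ^ξ𝐀|_X} < α₂. (4.4)"*, Cauchy bounds in the radius-α₂ polydisc), (4.5) p. 282 (the
Cauchy estimate with the factors `E₀ exp(−κd_j(X)) exp(−δ₀ dist^{(ξ)}(X, supp(1 − ζ̃_□)))`), (4.35) p. 290, (4.37) p. 291,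
p. 282 (decay `e^{−δ₀ dist}` of the minimizers), (0.26), ⟹ (5.10) p. 293 *"The representation (4.37) yields
the following inequality |Π_{μν}(x − y)| ≤ O(1)E₀ exp(−δ₁|x − y|), (5.10) with a positive constant δ₁ determined by
δ₀, κ, and M (e.g., δ₁ = 1/2min{δ₀, κM⁻¹})."* (DOCFIX v1.1, GAPS G-beta-11: v1 dropped `E₀` and paraphrased inside the
quotation marks; verbatim now, render p045 re-read by the β lead) — the kernel theorem
`B12Decay510.decay510_of_analytic_leaves` (cell row b03-g3, GAPS C-b03g3-1), whose constant
`4·E₀·α₂⁻²·B₃²·e^{δ₁Mc₁}·K₀·K₁` is LINEAR in the activity: here `E₀ := A_rem` (`PolLeaves.decay510`, `polConst`).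
(L3) [I] (1.21)/(5.1): the `T ↗ ℤ⁴` limit — existence ASSERTED p. 264 (cell GAPS G-adv2-2); it is the `hlim` leaf of
`PolLeaves` (finite-volume bounds are volume-uniform: the torus size enters no printed constant).
(L4) [I] (1.22)/(5.42): `|β¹_{k+1}| ≤ A_rem · K_Π · S₄(δ₁) = ε₁ · K_rem`, `S_d(δ₁) = Σ_{x∈ℤ^d} |x|₁² e^{−δ₁|x|₁} < ∞`
(`B12Sec2to5.secondMoment_abs_le_of_decay510`; `remCoeff`, `Chain.abs_beta1_le`).
k-DEPENDENCE TABLE (printed definitions; none depends on k, on the history, on the volume, or on ε₁ except the explicit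
factor): O(1)=:A₂ ((2.41)); C₃ (p. 20: L, O(1)=:A₁, E₀, C₁, α₄, α₆, M, q, C₂, κ₁); κ ((1.18)); δ ((1.21) p. 9, fixed by
R22 from L); α₂, B₃ ([I] §§3–4: (3.32) and the α-restrictions of pp. 277–280, e.g. p. 277 after (3.37) *"Assume now
that B₃²O(1)Mα₀ < 1/2α₁"*; (4.4)–(4.5)); δ₀ ([I] p. 282 / [II] (1.18)); c₁ ((0.26)); K₀, K₁ (lattice-geometry sums —
K₀: the domain (tree) sum [II] (1.26) p. 8 *"Σ_{X∈𝐃_j, X⊃□′} exp(−κd_j(X)) ≤ O(1), (1.26) for κ sufficiently large."*,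
the silent input of the third members of the chains (0.26)/(0.30), [I] pp. 257–258 (`B12Decay510.TreeLeaf`; PROVED
modulo the volume leaf in cell module `B12TreeDecay`); K₁: the cube sum `Σ_{□∈π_j} e^{−a·dist(x,□)} ≤ K₁`, an
elementary lattice sum print does not display (part of "yields", p. 293; `B12Decay510.CubeSumLeaf`)); d = 4.  PRINTED
ORDER of choice ([II] pp. 8, 18–21; [I] Thm 2 p. 259 *"let γ be a sufficiently small positive constant"*, Thm 3
p. 264 *"The constants ε₀, ε₁, α₀, α₁ depend on M and satisfy numerous restrictions, which will become clear in the
proof. The constant γ depends on all other constants."*; cell SMALLNESS.md): L → δ → κ, κ₁ → M → α's, B₃ → E₀ → ε₁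
(R15, R23: UPPER bounds given the preceding) → γ (R16: `γ² ≤ γ₂ε₁²/(80κ)`).  `K_rem` is a function of constants
preceding ε₁; `β⁰` involves none of M, E₀, ε₁ (p. 267).

## 2. What the constant form buys (and that O(γ²) is not needed)

With the one-loop sign in the form (AF-0) `β⁰_{k+1} ≥ 2b₀ > 0` (all k, or for k ≥ k₀) and ONE MORE upper restriction
on ε₁ of the printed type, `ε₁ · K_rem ≤ b₀` (inserted at the position of R23; `b₀` and `K_rem` are ε₁-free, γ is
chosen afterwards), the split gives `β_{k+1} ≥ b₀` on `]0,γ]^{k+1}` (`betaLowerH_of_split_const`,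
`betaLowerTail_of_remainderConst`) — the input `hlo`/`htail` of `FlowStepRuns.thm2Printed_of_boxBoundsH` /
`endpointExistence_of_eventualLower` / `p355Unconditional_and_sum246_of_eventualLower`.  Neither the O(γ²) remainder of
`FlowStep.BetaPertH` (rigid: `BetaPertRigid`) nor the linear form (AF-1) `|β¹_{k+1}| ≤ C g_k` (cell row pv20, located
failure G-pv20-3 at the cubic INSERTION estimate (P1)) is consumed by any located consumer; the constant form is the
sub-cell's (AF-1w) with the k-uniform modulus `ω := ε₁K_rem` (BETA-SPEC §4, co-lead remark (b)).  NOT OBTAINED here and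
not claimed: `ω(γ₀) → 0` as `γ₀ → 0` at FIXED ε₁ (that is the linear/(P1) road: [II] p. 8 after (1.29) *"Another
possibility is to use the expression g_k|B| instead of ε₁. It gives a better bound, but the above is simpler."* — not
carried out in print).

## 3. Large fields

β is DEFINED from the small-field effective action alone ([I] (1.20)–(1.22), (2.15)); the large-field papers consume
the flow and constrain γ, they do not modify β: [Balaban1989LargeFieldII] Thm 1 p. 355 hypothesis *"the sequence is
defined for β_k … effective coupling constants contained in ]0,γ]"* and p. 355 *"Theorem 2 of [I] allows us to remove the
assumption"*.  So no large-field term enters the remainder chain (cell SMALLNESS.md for the γ/ε bookkeeping of [III],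
[LF-I], [LF-II]).

## 4–6. (kernel) — see the declarations.   ## 7. Census of what stays located — see the docstring of `Chain`
and `BETA/REMAINDER-BETA.md` §6: the leaves (a)–(g) of GAPS G-B12s-15 ((4.35) incl. the (3.56) locus G-B12-07, (4.37),
p. 282, (0.26), (5.1)), the `T ↗ ℤ⁴` existence G-adv2-2, the [II] §2 loci behind (2.38)/(2.41) (G-B13-07…10: (2.16),
(2.29)–(2.32) with stated repairs, (2.36); the by-reference resummation (2.38) ⇒ (2.41), G-B13-11 = `B13.CammarotaStep`),
joint continuity (C) (per scale, `BetaDerivClause.betaContH_of_coordLipschitz`), and the one-loop rows (AF-0)/(T2b).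
-/

namespace Literature.MathematicalPhysics.QuantumFieldTheory.Balaban1983to89.Beta.RemainderChain

open Literature.MathematicalPhysics.QuantumFieldTheory.Balaban1983to89
open FlowStep DagBinding FlowStepRuns
open Metric Filter Topology

noncomputable section

/-! ## 4. (L1) The activity of the (2.13)-half is LINEAR in ε₁: (2.41) + "(1 − 10δ)ℓ = 1", WITHOUT R23 -/

/-- The activity constant of the (2.13)-terms read off (2.41) p. 21 [21] BEFORE the "unessential" assumption R23:
`A_rem := O(1) · C₃ · ε₁` (`A₂` = the printed O(1) of (2.41), `C3act` = the printed C₃ of p. 20).  Print replaces it by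
`½E₀` via R23 (`B13.bound118_of_bound241`); the β-function bound keeps the factor ε₁. [cite: Balaban1988RG2Cluster, (2.41) p.21] -/
def remActivity (c : B13.Consts) : ℝ := c.A₂ * c.C3act * c.ε₁

/-- `A_rem` is ε₁ times an ε₁-free constant: `A_rem = ε₁ · (O(1) · 2(L+2)⁴ O(1) · E₀ · 2C₁α₄⁻¹α₆⁻¹M^q e^{C₂κ₁})`
(p. 20 definition of C₃; `B13.Consts.K₀` = the E₀-, ε₁-free kernel). [cite: Balaban1988RG2Cluster, p.20 (definition of C₃)] -/
theorem remActivity_eq (c : B13.Consts) :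
    remActivity c = c.ε₁ * (c.A₂ * (2 * ((c.L : ℝ) + 2) ^ 4 * c.A₁ * (c.E₀ * c.K₀))) := by
  unfold remActivity B13.Consts.C3act; ring

/-- The printed product: `A_rem = O(1) · 2(L+2)⁴O(1) · 2E₀C₁α₄⁻¹α₆⁻¹M^q exp C₂κ₁ · ε₁` — no k, no volume, no history.
[cite: Balaban1988RG2Cluster, p.20 (definition of C₃)] -/
theorem remActivity_printed (c : B13.Consts) : remActivity c =
    c.A₂ * (2 * ((c.L : ℝ) + 2) ^ 4 * c.A₁ *
      (2 * c.E₀ * c.C₁ * c.α₄⁻¹ * c.α₆⁻¹ * c.M ^ c.q * Real.exp (c.C₂ * c.κ₁))) * c.ε₁ := by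
  rw [remActivity, B13.Consts.C3act_printed]

/-- `A_rem = O(1) · 2(L+2)⁴O(1) · ε₂` with the p. 19 product ε₂ (p. 20 *"We leave one factor 2(L+2)⁴O(1)ε₂"*).
[cite: Balaban1988RG2Cluster, p.20 (definition of C₃)] -/
theorem remActivity_eq_eps2 (c : B13.Consts) :
    remActivity c = c.A₂ * (2 * ((c.L : ℝ) + 2) ^ 4 * c.A₁) * c.eps2 := by
  unfold remActivity B13.Consts.C3act B13.Consts.eps2; ring

/-- The second "last assumption" R23 of p. 21 IS `A_rem ≤ ½E₀` (so the β-side restriction `ε₁K_rem ≤ b₀` below is of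
the same printed type: an upper bound on ε₁ given the preceding constants). [cite: Balaban1988RG2Cluster, p.21 (after (2.41))] -/
theorem R23_iff_remActivity (c : B13.Consts) : c.R23 ↔ remActivity c ≤ c.E₀ / 2 := Iff.rfl

/-- **(L1), kernel-checked.**  p. 21 [21]: (2.41) with a transfer factor ℓ (`B13.Bound241With`; printed ℓ = ½L,
certified reading ℓ = L / a_L, cell GAPS C-B13-09) and the first "last assumption" `(1 − 10δ)ℓ = 1` ALONE give the
(I.1.18)-shape bound for the (2.13)-terms `𝐄^{(k+1)}(X)` on `𝐔ᶜ_{k+1}(X, α₀, α₁)` with activity `A_rem = O(1)C₃ε₁` and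
rate κ — R23 is NOT used.  Real arithmetic. [cite: Balaban1988RG2Cluster, (2.41) p.21] -/
theorem bound118_linear_of_bound241With (S : B13.StepData) (c : B13.Consts) {ℓ : ℝ}
    (h241 : B13.Bound241With S c ℓ) (h22 : c.R22gen ℓ) :
    B13.Bound118 S.Dk1 S.sp2 S.Ek1 (remActivity c) c.κ := by
  intro X φ hφ
  have hrate : (1 - 10 * c.δ) * ℓ * c.κ * S.Dk1.dj X = c.κ * S.Dk1.dj X := by
    have h22' : (1 - 10 * c.δ) * ℓ = 1 := h22
    rw [h22', one_mul]
  have h := h241 X φ hφ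
  rw [hrate] at h
  rw [remActivity, neg_mul]
  exact h

/-- (L1) with the printed transfer factor ½L: (2.41) ∧ `(1 − 10δ)½L = 1` ⇒ `|𝐄^{(k+1)}(X)| ≤ O(1)C₃ε₁ e^{−κd_{k+1}(X)}`.
[cite: Balaban1988RG2Cluster, (2.41) p.21] -/
theorem bound118_linear_of_bound241 (S : B13.StepData) (c : B13.Consts) (h241 : B13.Bound241 S c)
    (h22 : c.R22) : B13.Bound118 S.Dk1 S.sp2 S.Ek1 (remActivity c) c.κ :=
  bound118_linear_of_bound241With S c ((B13.bound241With_half S c).mpr h241) ((B13.Consts.R22gen_half_iff c).mpr h22)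

/-- **The seam (L1) → (L2)** ([I] p. 281 (4.4): *"Thus it is defined and analytic on the space of configurations 𝐀
satisfying max{|𝐀|_X, |P₁(□₀)𝐀|_X, |∇^ξ𝐀|_X, |Δ^ξ𝐀|_X} < α₂. (4.4)"* — the external-field polydisc of radius α₂ is mapped INTO `𝐔ᶜ(X, α₀, α₁)` by
`𝐔_{j+1} ↦ 𝐔_{j+1} exp(iB)`-type substitutions).  If `emb X` maps the radius-α₂ ball of the external-field space into
`sp X` and `EX X = E X ∘ emb X`, an (I.1.18)-bound on `sp X` gives the `h118` leaf of `B12Decay510` on the ball with the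
SAME activity and rate.  Pure bookkeeping; the printed restrictions tying α₂ to α₀, α₁ ([I] §3: (3.32) p. 277 and the
α-assumptions of pp. 277–280, e.g. *"Assume now that B₃²O(1)Mα₀ < 1/2α₁"* after (3.37) p. 277; p. 281 invokes the
gauge transformation of (3.37)) are the hypothesis `hemb`. [cite: Balaban1987RG1, (4.4) p.281] -/
theorem h118_of_bound118 {D : LocDomainSys} {Φ W : Type*} [NormedAddCommGroup W] (sp : D.Dom → Set Φ)
    (E : D.Dom → Φ → ℂ) (emb : D.Dom → W → Φ) (EX : D.Dom → W → ℂ) {A κ α₂ : ℝ}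
    (hemb : ∀ X, ∀ v ∈ ball (0 : W) α₂, emb X v ∈ sp X) (hcomp : ∀ X v, EX X v = E X (emb X v))
    (hB : B13.Bound118 D sp E A κ) :
    ∀ X, ∀ v ∈ ball (0 : W) α₂, ‖EX X v‖ ≤ A * Real.exp (-κ * D.dj X) := by
  intro X v hv
  rw [hcomp]
  exact hB X (emb X v) (hemb X v hv)

/-! ## 5. (L2)–(L4) The (5.10) decay of the remainder polarization and its second moment, LINEAR in the activity -/

/-- The activity-free factor of the (5.10) constant delivered by `B12Decay510.decay510_of_analytic_leaves`:
`K_Π := 4 α₂⁻² B₃² e^{δ₁Mc₁} K₀ K₁`, `δ₁ = ½min{δ₀, κM⁻¹}` ([I] (4.3)–(4.4) p. 281, (4.5) p. 282: `4/α₂²` = the Cauchy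
constant for two derivatives; (4.35): B₃; p. 282: δ₀; (4.37)/(0.26): M, c₁; the tree sum K₀ ([II] (1.26) p. 8, [I]
(0.26)/(0.30) pp. 257–258) and the cube sum K₁ (elementary, not displayed in print)).  k-, volume-, history- and
ε₁-free by the printed definitions. [cite: Balaban1987RG1, (5.10) p.293] -/
def polConst (α₂ B₃ κ δ₀ M c₁ K₀ K₁ : ℝ) : ℝ :=
  4 / α₂ ^ 2 * B₃ ^ 2 * Real.exp (B12Decay510.delta1 δ₀ κ M * M * c₁) * K₀ * K₁

/-- `K_Π ≥ 0` for `K₀, K₁ ≥ 0`. [folklore] -/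
theorem polConst_nonneg {α₂ B₃ κ δ₀ M c₁ K₀ K₁ : ℝ} (hK₀ : 0 ≤ K₀) (hK₁ : 0 ≤ K₁) :
    0 ≤ polConst α₂ B₃ κ δ₀ M c₁ K₀ K₁ := by
  unfold polConst; positivity

/-- The constant of `decay510_of_analytic_leaves` IS `activity × K_Π`. [folklore] -/
theorem decayConst_eq (A α₂ B₃ κ δ₀ M c₁ K₀ K₁ : ℝ) :
    4 * A / α₂ ^ 2 * B₃ ^ 2 * Real.exp (B12Decay510.delta1 δ₀ κ M * M * c₁) * K₀ * K₁ =
      A * polConst α₂ B₃ κ δ₀ M c₁ K₀ K₁ := by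
  unfold polConst; ring

/-- **The leaves of [I] (4.37) ⇒ (5.10) for ONE limit kernel `P` on ℤ^d with activity `A`** — exactly the hypotheses of
`B12Decay510.decay510_of_analytic_leaves` (cell row b03-g3, GAPS C-b03g3-1 / G-b03g3-1), bundled: along an exhausting
sequence of tori, localized analytic terms `EXn n X` on the radius-α₂ ball of an external-field space with the
(1.18)-type bound `A e^{−κ d(X)}` ((4.3)–(4.4) p. 281, (4.5) p. 282), the polarization terms as second derivatives along
directions `hn` with the minimizer decay `B₃e^{−δ₀ dist}` ((4.35) p. 290, p. 282), the geometry (4.37)/(0.26), the tree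
sum ([II] (1.26) p. 8 / [I] (0.26), (0.30) pp. 257–258) and the cube sum, and the `T ↗ ℤ^d` limit (5.1) (existence
ASSERTED p. 264 *"This limit exists by the localized representation (1.7)."*: cell GAPS G-adv2-2).  Carrier types in
`Type`; the normed-space structures of the external-field spaces are FIELDS (no global instance is registered). [cite: Balaban1987RG1, (4.37) p.291 and (5.10) p.293] -/
structure PolLeaves (d : ℕ) (P : (Fin d → ℤ) → ℝ) (A α₂ B₃ κ δ₀ M c₁ K₀ K₁ : ℝ) where
  Sn : ℕ → LocDomainSys
  Cn : (n : ℕ) → B12.CubeCover (Sn n)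
  Λn : ℕ → Type
  Gn : (n : ℕ) → B12Decay510.SiteGeometry (Cn n) (Λn n)
  ρn : (n : ℕ) → Λn n → Λn n → ℝ
  Wn : ℕ → Type
  [instW : ∀ n, NormedAddCommGroup (Wn n)]
  [instWs : ∀ n, NormedSpace ℂ (Wn n)]
  EXn : (n : ℕ) → (Sn n).Dom → Wn n → ℂ
  hn : (n : ℕ) → (Sn n).Dom → Λn n → Wn n
  E2n : (n : ℕ) → (Sn n).Dom → Λn n → Λn n → ℝ
  e : (n : ℕ) → (Fin d → ℤ) → Λn n
  han : ∀ n X, AnalyticOnNhd ℂ (EXn n X) (ball 0 α₂)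
  h118 : ∀ n X, ∀ v ∈ ball (0 : Wn n) α₂, ‖EXn n X v‖ ≤ A * Real.exp (-κ * (Sn n).dj X)
  hrepr : ∀ n X x y, E2n n X x y = (B12Decay510.mixedDeriv (EXn n X) (hn n X x) (hn n X y)).re
  hh : ∀ n X x, ‖hn n X x‖ ≤ B₃ * Real.exp (-δ₀ * (Gn n).distD x X)
  hgeo : ∀ n, B12Decay510.GeomLeaf (Gn n) (ρn n) M c₁
  hcube : ∀ n, B12Decay510.CubeSumLeaf (Gn n) (δ₀ / 2) K₁
  htree : ∀ n, B12Decay510.TreeLeaf (Cn n) (κ / 2) K₀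
  hρ : ∀ z, ∀ᶠ n in atTop, ρn n (e n 0) (e n z) = B12Sec2to5.l1 z
  hlim : ∀ z, Tendsto (fun n => ∑ X, E2n n X (e n 0) (e n z)) atTop (𝓝 (P z))

/-- **(L2)–(L3), kernel-checked: (5.10) with a constant LINEAR in the activity.**  The leaves give
`|P(x)| ≤ A · K_Π · e^{−δ₁|x|₁}`, `δ₁ = ½min{δ₀, κM⁻¹}` (= `B12Decay510.decay510_of_analytic_leaves` with `E₀ := A`).
[cite: Balaban1987RG1, (5.10) p.293] -/
theorem PolLeaves.decay510 {d : ℕ} {P : (Fin d → ℤ) → ℝ} {A α₂ B₃ κ δ₀ M c₁ K₀ K₁ : ℝ}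
    (Lv : PolLeaves d P A α₂ B₃ κ δ₀ M c₁ K₀ K₁) (hα₂ : 0 < α₂) (hA : 0 ≤ A) (hB₃ : 0 ≤ B₃) (hK₀ : 0 ≤ K₀)
    (hδ₀ : 0 ≤ δ₀) (hκ : 0 ≤ κ) (hM : 0 < M) :
    B12Sec2to5.Decay510 P (A * polConst α₂ B₃ κ δ₀ M c₁ K₀ K₁) (B12Decay510.delta1 δ₀ κ M) := by
  have h := @B12Decay510.decay510_of_analytic_leaves d Lv.Sn Lv.Cn Lv.Λn Lv.Gn Lv.ρn Lv.Wn Lv.instW Lv.instWs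
    Lv.EXn Lv.hn Lv.E2n Lv.e P _ _ _ _ _ _ _ _ _ hα₂ hA hB₃ hK₀ hδ₀ hκ hM Lv.han Lv.h118 Lv.hrepr Lv.hh Lv.hgeo
    Lv.hcube Lv.htree Lv.hρ Lv.hlim
  rw [decayConst_eq] at h
  exact h

/-- `β′(a·C) = a·β′(C)` for the printed second-moment majorant `β′ = C · Σ_x |x|₁² e^{−δ₁|x|₁}` of (5.42). [folklore] -/
theorem betaPrime510_mul (d : ℕ) (a C δ₁ : ℝ) :
    B12Sec2to5.betaPrime510 d (a * C) δ₁ = a * B12Sec2to5.betaPrime510 d C δ₁ := by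
  unfold B12Sec2to5.betaPrime510; ring

/-- **(L4), kernel-checked: (1.22)/(5.42) with a constant LINEAR in the activity.**  (5.10) for the `(μ,ν)` component
with constant `A·K` ⇒ `|−… Σ_x Π(x) x_μ x_ν| ≤ A · β′(K)` (`B12Sec2to5.secondMoment_abs_le_of_decay510`).
[cite: Balaban1987RG1, (5.42) p.297] -/
theorem abs_secondMoment_le_linear {d : ℕ} {P : B12Beta.Kernel d} {A K δ₁ : ℝ} {μ ν : Fin d} (hδ : 0 < δ₁)
    (h : B12Sec2to5.Decay510 (P μ ν) (A * K) δ₁) :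
    |B12Beta.secondMoment P μ ν| ≤ A * B12Sec2to5.betaPrime510 d K δ₁ := by
  have h2 := (B12Sec2to5.secondMoment_abs_le_of_decay510 hδ h).2
  have e : B12Sec2to5.betaPrime510 d (A * K) δ₁ =
      A * K * ∑' x : Fin d → ℤ, B12Sec2to5.l1 x ^ 2 * Real.exp (-δ₁ * B12Sec2to5.l1 x) := rfl
  rw [← betaPrime510_mul, e]
  exact h2

/-! ## 6. The remainder chain per scale and history, and the k-UNIFORM constant-form bound -/

/-- The REMAINDER COEFFICIENT `K_rem := O(1) · C₃ · β′_d(K_Π, δ₁)` — so that the chain gives `|β¹_{k+1}| ≤ ε₁ · K_rem`;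
a function of (L, O(1)'s, E₀, C₁, C₂, α₂, α₄, α₆, M, q, κ, κ₁, δ₀, B₃, c₁, K₀, K₁, d) only: ε₁-FREE, k-free,
history-free (§1 table). [cite: Balaban1988RG2Cluster, p.20 (definition of C₃); Balaban1987RG1, (5.10) p.293] -/
def remCoeff (d : ℕ) (c : B13.Consts) (α₂ B₃ c₁ K₀ K₁ : ℝ) : ℝ :=
  c.A₂ * c.C3act *
    B12Sec2to5.betaPrime510 d (polConst α₂ B₃ c.κ c.δ₀ c.M c₁ K₀ K₁) (B12Decay510.delta1 c.δ₀ c.κ c.M)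

/-- `ε₁ · K_rem = A_rem · β′_d(K_Π, δ₁)`. [folklore] -/
theorem eps1_mul_remCoeff (d : ℕ) (c : B13.Consts) (α₂ B₃ c₁ K₀ K₁ : ℝ) :
    c.ε₁ * remCoeff d c α₂ B₃ c₁ K₀ K₁ = remActivity c *
      B12Sec2to5.betaPrime510 d (polConst α₂ B₃ c.κ c.δ₀ c.M c₁ K₀ K₁) (B12Decay510.delta1 c.δ₀ c.κ c.M) := by
  unfold remCoeff remActivity; ring

/-- **THE REMAINDER CHAIN for the β-family `β` with one-loop split `S`, on the boxes `]0,γ]^{k+1}`, with the constants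
of [II] (`c : B13.Consts`: O(1)'s, C₃, ε₁, κ, δ₀, M, …) and of [I] §§3–4 (α₂, B₃, c₁, K₀, K₁).**  Fields: `P1 k p` = the
`T ↗ ℤ^d` limit polarization kernel Π¹_{k+1}(g_0,…,g_k; ·) of the (2.13)-half; `beta1_eq` = (1.20)/(1.22) applied to that
half (the dictionary clause: β¹ IS its second moment — linearity of (1.20), (1.22) in the action); `leaves k p hp` = the
leaves of (4.37) ⇒ (5.10) for Π¹_{k+1} with activity `A_rem = O(1)C₃ε₁` ((L1): [II] (2.41) + R22 via
`bound118_linear_of_bound241` and the seam `h118_of_bound118`) and THE SAME constants for every k and every history —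
which is what the printed definitions say (§1 table).  WHAT STAYS LOCATED inside `leaves`: (4.35) incl. the (3.56) locus,
(4.37), p. 282, (0.26) (GAPS G-B12s-15 (a)–(g)); the limit (5.1) (G-adv2-2); behind the activity, [II] §2's loci
(G-B13-07…11).  NOT a discharge of any of them. [cite: Balaban1987RG1, (1.20)-(1.22) p.264 and (5.10) p.293; Balaban1988RG2Cluster, (2.41) p.21] -/
structure Chain (d : ℕ) (μ ν : Fin d) {β : HBeta} (S : B12Beta.OneLoopSplit β) (γ : ℝ) (c : B13.Consts)
    (α₂ B₃ c₁ K₀ K₁ : ℝ) where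
  P1 : (k : ℕ) → (Fin (k + 1) → ℝ) → B12Beta.Kernel d
  beta1_eq : ∀ k p, p ∈ B12Beta.HistBox γ k → S.β1 k p = B12Beta.secondMoment (P1 k p) μ ν
  leaves : ∀ k p, p ∈ B12Beta.HistBox γ k →
    PolLeaves d (P1 k p μ ν) (remActivity c) α₂ B₃ c.κ c.δ₀ c.M c₁ K₀ K₁

/-- The signs of the printed constants used by the chain (all hold for the printed choices: α₂, M, δ₀, κ > 0;
B₃, K₀ ≥ 0; O(1), C₃, ε₁ ≥ 0). [folklore] -/
structure ChainSigns (c : B13.Consts) (α₂ B₃ K₀ : ℝ) : Prop where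
  act : 0 ≤ remActivity c
  α₂_pos : 0 < α₂
  B₃_nonneg : 0 ≤ B₃
  K₀_nonneg : 0 ≤ K₀
  δ₀_pos : 0 < c.δ₀
  κ_pos : 0 < c.κ
  M_pos : 0 < c.M

/-- The CONSTANT FORM of the remainder bound on the boxes: `|β¹_{k+1}(g_0,…,g_k)| ≤ r` for all k and all histories in
`]0,γ]^{k+1}` — the sub-cell's (AF-1w) with a k-uniform modulus `r` (BETA-SPEC §4 (b)); weaker than (AF-1)
`|β¹_{k+1}| ≤ C g_k` (which gives it with `r = Cγ`). [cite: Balaban1987RG1, Thm 2 p.259] -/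
def RemainderConst {β : HBeta} (S : B12Beta.OneLoopSplit β) (γ r : ℝ) : Prop :=
  ∀ k p, p ∈ B12Beta.HistBox γ k → |S.β1 k p| ≤ r

/-- (AF-1) ⇒ the constant form with `r = Cγ`. [folklore] -/
theorem remainderConst_of_af1 {β : HBeta} (S : B12Beta.OneLoopSplit β) {C γ : ℝ} (hC : 0 ≤ C)
    (hAF1 : ∀ k (p : Fin (k + 1) → ℝ), p ∈ B12Beta.HistBox γ k → |S.β1 k p| ≤ C * p (Fin.last k)) :
    RemainderConst S γ (C * γ) := fun k p hp =>
  (hAF1 k p hp).trans (mul_le_mul_of_nonneg_left (hp (Fin.last k)).2 hC)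

/-- **THE k-UNIFORM REMAINDER BOUND, kernel-checked from the printed chain**: a remainder chain with the printed signs
gives `|β¹_{k+1}(g_0,…,g_k)| ≤ ε₁ · K_rem` for EVERY scale k and EVERY history in `]0,γ]^{k+1}` — one constant, linear
in ε₁, ε₁-free otherwise.  This is the bound the printed estimates [II] (2.41) → [I] (4.3)–(4.5), (4.37), (5.10) →
(1.22) deliver for the non-Gaussian part of β; it is O(ε₁), not O(g_k) and not O(γ²). [cite: Balaban1988RG2Cluster, (2.41) p.21; Balaban1987RG1, (5.10) p.293 and (1.22) p.264] -/
theorem Chain.abs_beta1_le {d : ℕ} {μ ν : Fin d} {β : HBeta} {S : B12Beta.OneLoopSplit β} {γ : ℝ}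
    {c : B13.Consts} {α₂ B₃ c₁ K₀ K₁ : ℝ} (R : Chain d μ ν S γ c α₂ B₃ c₁ K₀ K₁)
    (hs : ChainSigns c α₂ B₃ K₀) :
    RemainderConst S γ (c.ε₁ * remCoeff d c α₂ B₃ c₁ K₀ K₁) := by
  intro k p hp
  have hδ₁ : 0 < B12Decay510.delta1 c.δ₀ c.κ c.M := B12Decay510.delta1_pos hs.δ₀_pos hs.κ_pos hs.M_pos
  have hdec := (R.leaves k p hp).decay510 hs.α₂_pos hs.act hs.B₃_nonneg hs.K₀_nonneg hs.δ₀_pos.le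
    hs.κ_pos.le hs.M_pos
  rw [R.beta1_eq k p hp, eps1_mul_remCoeff]
  exact abs_secondMoment_le_linear hδ₁ hdec

/-! ## 7. Consumers: the constant form is all the located consumers of the flow use -/

/-- **The lower bound `β_{k+1} ≥ b` on ALL boxes from the split, CONSTANT FORM**: (AF-0) `β⁰_{k+1} ≥ 2b` for all k and
`|β¹_{k+1}| ≤ r ≤ b` on `]0,γ]^{k+1}` give `FlowStep.BetaLowerH b γ β` — the input `hlo` of
`FlowStepRuns.thm2Printed_of_boxBoundsH`.  Compare `FlowStep.betaLowerH_of_split` ((AF-1) + `Cγ ≤ b`): no γ-smallness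
is spent here; the smallness is `r ≤ b`, i.e. on ε₁. [cite: Balaban1987RG1, Thm 2 p.259] -/
theorem betaLowerH_of_split_const {β : HBeta} (S : B12Beta.OneLoopSplit β) {b r γ : ℝ}
    (hAF0 : ∀ k, 2 * b ≤ S.β0 k) (hrem : RemainderConst S γ r) (hr : r ≤ b) : BetaLowerH b γ β := by
  intro k v hv
  have h1 := (abs_le.mp (hrem k v (histBox_of_mem_box hv))).1
  rw [S.split k v]
  linarith [hAF0 k]

/-- The one-sided tail input `hAF1w` of `FlowStepRuns.betaLowerTail_of_split_oneSided` from the constant form (from any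
k₀ on; the constant form holds for all k). [folklore] -/
theorem af1w_of_remainderConst {β : HBeta} (S : B12Beta.OneLoopSplit β) {b r γ : ℝ} (k₀ : ℕ)
    (hrem : RemainderConst S γ r) (hr : r ≤ b) :
    ∀ k, k₀ ≤ k → ∀ v ∈ Box γ k, -b ≤ S.β1 k v := fun k _ v hv =>
  (neg_le_neg hr).trans (abs_le.mp (hrem k v (histBox_of_mem_box hv))).1

/-- **(EV-AF) from the split, CONSTANT FORM on the tail**: `β⁰_{k+1} ≥ 2b` for `k ≥ k₀` (e.g. from plain convergence
`β⁰_{k+1} → β⁰_∞ > 0`, rows an2/an3/pv05) and `|β¹_{k+1}| ≤ r ≤ b` give `β_{k+1} ≥ b` on the boxes for `k ≥ k₀` — the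
input `htail` of `FlowStepRuns.endpointExistence_of_eventualLower` / `p355Unconditional_and_sum246_of_eventualLower`.
[cite: Balaban1987RG1, Thm 2 p.259] -/
theorem betaLowerTail_of_remainderConst {β : HBeta} (S : B12Beta.OneLoopSplit β) {b r γ : ℝ} {k₀ : ℕ}
    (hAF0 : ∀ k, k₀ ≤ k → 2 * b ≤ S.β0 k) (hrem : RemainderConst S γ r) (hr : r ≤ b) :
    ∀ k, k₀ ≤ k → ∀ v ∈ Box γ k, b ≤ β k v :=
  betaLowerTail_of_split_oneSided S hAF0 (af1w_of_remainderConst S k₀ hrem hr)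

/-- The ε₁-restriction is satisfiable: for `b > 0` and any `K` there is `ε₁ > 0` with `ε₁ K ≤ b` (the restriction is of
the printed type "ε₁ sufficiently small given the preceding constants", inserted next to R23 p. 21; γ is chosen after
ε₁, [I] Thm 3 p. 264). [cite: Balaban1988RG2Cluster, p.21 (after (2.41))] -/
theorem exists_eps1_le (b K : ℝ) (hb : 0 < b) : ∃ ε₁ : ℝ, 0 < ε₁ ∧ ε₁ * K ≤ b := by
  rcases le_or_gt K 0 with hK | hK
  · exact ⟨1, one_pos, by nlinarith⟩
  · refine ⟨b / (K + 1), div_pos hb (by linarith), ?_⟩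
    rw [div_mul_eq_mul_div, div_le_iff₀ (by linarith)]
    nlinarith

/-- **END TO END, literal grade: `B12.Thm2Printed C L` from the remainder chain** — for a construction generated forward
by (0.20) with a continuous β-family split as β⁰ + β¹: (AF-0) `β⁰_{k+1} ≥ 2b > 0` (ALL k: the literal (0.31) needs the
small-k signs, BETA-SPEC §4 (d)), the remainder chain with the printed signs, the ε₁-restriction `ε₁K_rem ≤ b`, the
printed upper bound (TS) and joint continuity (C).  Inputs BY NAME that no printed source supplies: (AF-0), (C), the
leaves inside `R` (§7 of the header).  NOT Theorem 2 unconditionally. [cite: Balaban1987RG1, Thm 2 (0.31) p.259] -/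
theorem thm2Printed_of_remainderChain {C : B12.Construction} {β : HBeta} (hgen : ForwardGenerated C β)
    (S : B12Beta.OneLoopSplit β) {d : ℕ} {μ ν : Fin d} {c : B13.Consts} {α₂ B₃ c₁ K₀ K₁ L γ₀ b β' : ℝ}
    (R : Chain d μ ν S γ₀ c α₂ B₃ c₁ K₀ K₁) (hs : ChainSigns c α₂ B₃ K₀)
    (hL : 1 < L) (hγ₀ : 0 < γ₀) (hb : 0 < b) (hAF0 : ∀ k, 2 * b ≤ S.β0 k)
    (hε₁ : c.ε₁ * remCoeff d c α₂ B₃ c₁ K₀ K₁ ≤ b) (hcont : BetaContH γ₀ β) (hup : BetaUpperH β' γ₀ β) :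
    B12.Thm2Printed C L := by
  have hlo : BetaLowerH b γ₀ β := betaLowerH_of_split_const S hAF0 (R.abs_beta1_le hs) hε₁
  have hmem : (fun _ : Fin (0 + 1) => γ₀) ∈ Box γ₀ 0 := mem_box.mpr fun _ => ⟨hγ₀, le_rfl⟩
  have hbβ' : b ≤ β' := (hlo 0 _ hmem).trans (hup 0 _ hmem)
  exact thm2Printed_of_boxBoundsH hgen hL hγ₀ hb hbβ' hcont hlo hup

/-- **END TO END, end-statement grade: `DagBinding.EndpointExistence C` from the remainder chain on the TAIL** — (AF-0)
only for `k ≥ k₀` (plain convergence of the one-loop coefficients suffices upstream), the remainder chain, `ε₁K_rem ≤ b`,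
the printed two-sided bound `−β′ ≤ β_{k+1} ≤ β′` (TS, p. 264) and (C); via
`FlowStepRuns.endpointExistence_of_eventualLower` (no rate, no small-k signs).  Same located inputs as above minus the
small-k signs. [cite: Balaban1987RG1, Thm 2 p.259 (first sentence)] -/
theorem endpointExistence_of_remainderChain {C : B12.Construction} {β : HBeta} (hgen : ForwardGenerated C β)
    (S : B12Beta.OneLoopSplit β) {d : ℕ} {μ ν : Fin d} {c : B13.Consts} {α₂ B₃ c₁ K₀ K₁ γ₀ b β' : ℝ} {k₀ : ℕ}
    (R : Chain d μ ν S γ₀ c α₂ B₃ c₁ K₀ K₁) (hs : ChainSigns c α₂ B₃ K₀)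
    (hγ₀ : 0 < γ₀) (hb : 0 < b) (hβ' : 0 ≤ β') (hAF0 : ∀ k, k₀ ≤ k → 2 * b ≤ S.β0 k)
    (hε₁ : c.ε₁ * remCoeff d c α₂ B₃ c₁ K₀ K₁ ≤ b) (hcont : BetaContH γ₀ β)
    (hlo : ∀ k, ∀ v ∈ Box γ₀ k, -β' ≤ β k v) (hup : BetaUpperH β' γ₀ β) : EndpointExistence C :=
  endpointExistence_of_eventualLower hgen hγ₀ hb.le hβ' hcont
    (betaLowerTail_of_remainderConst S hAF0 (R.abs_beta1_le hs) hε₁) hlo hup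

end

end Literature.MathematicalPhysics.QuantumFieldTheory.Balaban1983to89.Beta.RemainderChain
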